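import Literature.AlgebraicGeometry.Frobenioids.KummerReciprocityFunctoriality
import HarnessLib

/-!
# Frobenioids II, Definition 2.2 (ii) / Theorem 2.4 (i): transport of the inflation maps and of
# `F_N(A)` along an isomorphism of ALL the data `(H ↠ H_A, μ_N(A))`

Mochizuki, *The geometry of Frobenioids II*, Kyushu J. Math. **62** (2008) 401–460, §2, Definition
2.2 (ii) p. 17 and Theorem 2.4 (i) pp. 19–20 [cite: MochizukiFrdII2008, Thm 2.4 (i) p.19]: an
equivalence `Ψ : C₁ ⥲ C₂` of `p`-adic Frobenioids "maps `(N, H₁)`-saturated objects to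
`(N, H₂)`-saturated objects and induces isomorphisms … `F_N(A₁) ⥲ F_N(A₂)`", which "follows
immediately from the fact that `Ψ` preserves `O^⊳(−)`, together with the manifestly
group-theoretic/category-theoretic construction" of the data (proof of Thm. 2.4 (i), p. 20).

This file PROVES the group-cohomological transport behind that sentence, generalising
`KummerReciprocityFunctoriality.lean` (abc-iut-L1-t7, SAME group `H` on both sides) to the situation
of Theorem 2.4 where BOTH groups change: given `q : H → K`, `q' : H' → K'` (in Def. 2.2: `Hᵢ ↠ (Hᵢ)_{Aᵢ}`),
isomorphisms of topological groups `e : K ⇄ K'`, `d : H ⇄ H'` with `q' ∘ d = e ∘ q`, and mutually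
inverse coefficient maps `f : res_e X' → X`, `f' : res_{e'} X → X'` (`InflTransport₂`), the inflation
maps `Hⁿ(K, X) → Hⁿ(H, X)` and `Hⁿ(K', X') → Hⁿ(H', X')` (Mathlib `ContinuousCohomology.map`) sit in a
commutative square whose other two sides are bijections (`square`, `pull_bijective`,
`pullH_bijective`); hence one is bijective (resp. surjective) iff the other is (`bijective_iff`,
`surjective_iff`), the kernels correspond (`map_pull_eq_zero_iff`), condition (c) of Def. 2.2 (ii)
transports (`isCohSaturated_iff`) and `F_N` transports (`fnEquiv`, with `fnEquiv_mk`). Everything is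
proved; no item of [FrdII] is restated; proof-side companion of abc-iut-L1-d4 (gen 2) to the
Theorem 2.4 schemas of `PadicKummerSetting.lean`.
-/

namespace Literature.AlgebraicGeometry.Frobenioids

namespace Kummer

open CategoryTheory

universe u v

section Transport

variable {k : Type u} [Ring k] [TopologicalSpace k]
variable {K K' H H' : Type v} [Group K] [TopologicalSpace K] [IsTopologicalGroup K]
  [Group K'] [TopologicalSpace K'] [IsTopologicalGroup K']
  [Group H] [TopologicalSpace H] [IsTopologicalGroup H]
  [Group H'] [TopologicalSpace H'] [IsTopologicalGroup H']

/-- Transport data between `(q : H → K, X)` and `(q' : H' → K', X')`: isomorphisms of topological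
groups `e : K ⇄ K' : e'` and `d : H ⇄ H' : d'` with `q' ∘ d = e ∘ q`, and mutually inverse
coefficient maps `f : res_e X' → X`, `f' : res_{e'} X → X'` (in Theorem 2.4 (i): `(Hᵢ)_{Aᵢ}`,
`Hᵢ`, `μ_N(Aᵢ)` for `i = 1, 2`, compared through `Ψ`). [cite: MochizukiFrdII2008, Thm 2.4 (i) p.19] -/
structure InflTransport₂ (q : H →ₜ* K) (q' : H' →ₜ* K') (X : TopRep k K) (X' : TopRep k K') where
  /-- `K → K'` -/
  e : K →ₜ* K'
  /-- `K' → K` -/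
  e' : K' →ₜ* K
  e'_e : ∀ x, e' (e x) = x
  e_e' : ∀ x, e (e' x) = x
  /-- `H → H'` -/
  d : H →ₜ* H'
  /-- `H' → H` -/
  d' : H' →ₜ* H
  d'_d : ∀ x, d' (d x) = x
  d_d' : ∀ x, d (d' x) = x
  q'_d : ∀ h, q' (d h) = e (q h)
  /-- coefficient map over `e` -/
  f : TopRep.res (e : K →* K') X' ⟶ X
  /-- coefficient map over `e'` -/
  f' : TopRep.res (e' : K' →* K) X ⟶ X'
  f'_f : ∀ x, f'.hom (f.hom x) = x
  f_f' : ∀ x, f.hom (f'.hom x) = x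

namespace InflTransport₂

variable {q : H →ₜ* K} {q' : H' →ₜ* K'} {X : TopRep k K} {X' : TopRep k K'}
  (T : InflTransport₂ q q' X X')

omit [IsTopologicalGroup K] [IsTopologicalGroup K'] [IsTopologicalGroup H]
  [IsTopologicalGroup H'] in
/-- `q ∘ d' = e' ∘ q'`. [cite: MochizukiFrdII2008, Thm 2.4 (i) p.19] -/
theorem q_d' (h' : H') : q (T.d' h') = T.e' (q' h') := by
  rw [← T.e'_e (q (T.d' h')), ← T.q'_d, T.d_d']

/-- The comparison `Hⁿ(K', X') → Hⁿ(K, X)`. [cite: MochizukiFrdII2008, Thm 2.4 (i) p.19] -/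
noncomputable def pull (n : ℕ) : continuousCohomology n X' ⟶ continuousCohomology n X :=
  ContinuousCohomology.map T.e T.f n

/-- Its inverse `Hⁿ(K, X) → Hⁿ(K', X')`. [cite: MochizukiFrdII2008, Thm 2.4 (i) p.19] -/
noncomputable def push (n : ℕ) : continuousCohomology n X ⟶ continuousCohomology n X' :=
  ContinuousCohomology.map T.e' T.f' n

omit [IsTopologicalGroup H] [IsTopologicalGroup H'] in
/-- `pull ≫ push = 𝟙`. [cite: MochizukiFrdII2008, Thm 2.4 (i) p.19] -/
theorem pull_push (n : ℕ) : T.pull n ≫ T.push n = 𝟙 _ := by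
  rw [pull, push, ← ContinuousCohomology.map_comp]
  exact contMap_eq_id _ _ (ContinuousMonoidHom.ext fun x => T.e_e' x) (fun x => T.f'_f x) n

omit [IsTopologicalGroup H] [IsTopologicalGroup H'] in
/-- `push ≫ pull = 𝟙`. [cite: MochizukiFrdII2008, Thm 2.4 (i) p.19] -/
theorem push_pull (n : ℕ) : T.push n ≫ T.pull n = 𝟙 _ := by
  rw [pull, push, ← ContinuousCohomology.map_comp]
  exact contMap_eq_id _ _ (ContinuousMonoidHom.ext fun x => T.e'_e x) (fun x => T.f_f' x) n

omit [IsTopologicalGroup H] [IsTopologicalGroup H'] in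
/-- `push (pull x) = x`. [cite: MochizukiFrdII2008, Thm 2.4 (i) p.19] -/
theorem push_pull_apply (n : ℕ) (x : continuousCohomology n X') :
    (T.push n).hom ((T.pull n).hom x) = x := by
  have h := congr_arg (fun φ => φ.hom x) (T.pull_push n)
  simpa using h

omit [IsTopologicalGroup H] [IsTopologicalGroup H'] in
/-- `pull (push x) = x`. [cite: MochizukiFrdII2008, Thm 2.4 (i) p.19] -/
theorem pull_push_apply (n : ℕ) (x : continuousCohomology n X) :
    (T.pull n).hom ((T.push n).hom x) = x := by
  have h := congr_arg (fun φ => φ.hom x) (T.push_pull n)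
  simpa using h

omit [IsTopologicalGroup H] [IsTopologicalGroup H'] in
/-- `pull` is bijective. [cite: MochizukiFrdII2008, Thm 2.4 (i) p.19] -/
theorem pull_bijective (n : ℕ) : Function.Bijective (T.pull n).hom :=
  Function.bijective_iff_has_inverse.mpr
    ⟨(T.push n).hom, fun x => T.push_pull_apply n x, fun x => T.pull_push_apply n x⟩

/-- `pull` as an isomorphism of abelian groups `Hⁿ(K', X') ≃+ Hⁿ(K, X)`.
[cite: MochizukiFrdII2008, Thm 2.4 (i) p.19] -/
noncomputable def pullAddEquiv (n : ℕ) : continuousCohomology n X' ≃+ continuousCohomology n X :=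
  { (T.pull n).hom.toLinearMap.toAddMonoidHom with
    invFun := (T.push n).hom
    left_inv := fun x => T.push_pull_apply n x
    right_inv := fun x => T.pull_push_apply n x }

omit [IsTopologicalGroup H] [IsTopologicalGroup H'] in
/-- `pullAddEquiv` is `pull` on elements. [cite: MochizukiFrdII2008, Thm 2.4 (i) p.19] -/
@[simp] theorem pullAddEquiv_apply (n : ℕ) (x : continuousCohomology n X') :
    T.pullAddEquiv n x = (T.pull n).hom x := rfl

omit [IsTopologicalGroup H] [IsTopologicalGroup H'] in
/-- The inverse of `pullAddEquiv` is `push` on elements. [cite: MochizukiFrdII2008, Thm 2.4 (i) p.19] -/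
@[simp] theorem pullAddEquiv_symm_apply (n : ℕ) (x : continuousCohomology n X) :
    (T.pullAddEquiv n).symm x = (T.push n).hom x := rfl

/-- The coefficient map `f` read over `d : H → H'`: `res_d (res_{q'} X') → res_q X`.
[cite: MochizukiFrdII2008, Thm 2.4 (i) p.19] -/
def fH : TopRep.res (T.d : H →* H') (TopRep.res (q' : H' →* K') X') ⟶ TopRep.res (q : H →* K) X :=
  TopRep.ofHom
    { toContinuousLinearMap := T.f.hom.toContinuousLinearMap
      isIntertwining' := fun h => by
        have := T.f.hom.isIntertwining' (q h)
        change T.f.hom.toContinuousLinearMap ∘L X'.ρ (q' (T.d h)) = X.ρ (q h) ∘L _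
        rw [T.q'_d h]
        exact this }

/-- Its inverse `res_{d'} (res_q X) → res_{q'} X'`. [cite: MochizukiFrdII2008, Thm 2.4 (i) p.19] -/
def fH' : TopRep.res (T.d' : H' →* H) (TopRep.res (q : H →* K) X) ⟶ TopRep.res (q' : H' →* K') X' :=
  TopRep.ofHom
    { toContinuousLinearMap := T.f'.hom.toContinuousLinearMap
      isIntertwining' := fun h' => by
        have := T.f'.hom.isIntertwining' (q' h')
        change T.f'.hom.toContinuousLinearMap ∘L X.ρ (q (T.d' h')) = X'.ρ (q' h') ∘L _
        rw [T.q_d' h']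
        exact this }

/-- The comparison `Hⁿ(H', X') → Hⁿ(H, X)` (coefficients restricted along `q'`, `q`).
[cite: MochizukiFrdII2008, Thm 2.4 (i) p.19] -/
noncomputable def pullH (n : ℕ) :
    continuousCohomology n (TopRep.res (q' : H' →* K') X') ⟶
      continuousCohomology n (TopRep.res (q : H →* K) X) :=
  ContinuousCohomology.map T.d T.fH n

/-- Its inverse `Hⁿ(H, X) → Hⁿ(H', X')`. [cite: MochizukiFrdII2008, Thm 2.4 (i) p.19] -/
noncomputable def pushH (n : ℕ) :
    continuousCohomology n (TopRep.res (q : H →* K) X) ⟶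
      continuousCohomology n (TopRep.res (q' : H' →* K') X') :=
  ContinuousCohomology.map T.d' T.fH' n

omit [IsTopologicalGroup K] [IsTopologicalGroup K'] in
/-- `pullH ≫ pushH = 𝟙`. [cite: MochizukiFrdII2008, Thm 2.4 (i) p.19] -/
theorem pullH_pushH (n : ℕ) : T.pullH n ≫ T.pushH n = 𝟙 _ := by
  rw [pullH, pushH, ← ContinuousCohomology.map_comp]
  exact contMap_eq_id _ _ (ContinuousMonoidHom.ext fun x => T.d_d' x) (fun x => T.f'_f x) n

omit [IsTopologicalGroup K] [IsTopologicalGroup K'] in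
/-- `pushH ≫ pullH = 𝟙`. [cite: MochizukiFrdII2008, Thm 2.4 (i) p.19] -/
theorem pushH_pullH (n : ℕ) : T.pushH n ≫ T.pullH n = 𝟙 _ := by
  rw [pullH, pushH, ← ContinuousCohomology.map_comp]
  exact contMap_eq_id _ _ (ContinuousMonoidHom.ext fun x => T.d'_d x) (fun x => T.f_f' x) n

omit [IsTopologicalGroup K] [IsTopologicalGroup K'] in
/-- `pullH` is bijective. [cite: MochizukiFrdII2008, Thm 2.4 (i) p.19] -/
theorem pullH_bijective (n : ℕ) : Function.Bijective (T.pullH n).hom := by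
  refine Function.bijective_iff_has_inverse.mpr ⟨(T.pushH n).hom, fun x => ?_, fun x => ?_⟩
  · have h := congr_arg (fun φ => φ.hom x) (T.pullH_pushH n)
    simpa using h
  · have h := congr_arg (fun φ => φ.hom x) (T.pushH_pullH n)
    simpa using h

/-- **The commutative square**: `(Hⁿ(K', X') → Hⁿ(H', X')) ≫ pullH = pull ≫ (Hⁿ(K, X) → Hⁿ(H, X))`.
[cite: MochizukiFrdII2008, Thm 2.4 (i) p.19] -/
theorem square (n : ℕ) :
    ContinuousCohomology.map q' (𝟙 _) n ≫ T.pullH n =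
      T.pull n ≫ ContinuousCohomology.map q (𝟙 _) n := by
  rw [pullH, pull, ← ContinuousCohomology.map_comp, ← ContinuousCohomology.map_comp]
  exact contMap_congr (φ := q'.comp T.d) (ψ := T.e.comp q)
    (ContinuousMonoidHom.ext fun h => T.q'_d h) _ _ (fun x => rfl) n

/-- The square on elements: `pullH (infl' x) = infl (pull x)`. [cite: MochizukiFrdII2008, Thm 2.4 (i) p.19] -/
theorem square_apply (n : ℕ) (x : continuousCohomology n X') :
    (T.pullH n).hom ((ContinuousCohomology.map q' (𝟙 _) n).hom x) =
      (ContinuousCohomology.map q (𝟙 _) n).hom ((T.pull n).hom x) := by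
  have h := congr_arg (fun φ => φ.hom x) (T.square n)
  simpa using h

include T in
/-- Transport of bijectivity of the inflation maps. [cite: MochizukiFrdII2008, Thm 2.4 (i) p.19] -/
theorem bijective_iff (n : ℕ) :
    Function.Bijective (ContinuousCohomology.map q (𝟙 (TopRep.res (q : H →* K) X)) n).hom ↔
      Function.Bijective
        (ContinuousCohomology.map q' (𝟙 (TopRep.res (q' : H' →* K') X')) n).hom := by
  have hsq : (T.pullH n).hom ∘ (ContinuousCohomology.map q' (𝟙 _) n).hom =
      (ContinuousCohomology.map q (𝟙 _) n).hom ∘ (T.pull n).hom :=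
    funext fun x => T.square_apply n x
  rw [← Function.Bijective.of_comp_iff _ (T.pull_bijective n), ← hsq,
    Function.Bijective.of_comp_iff' (T.pullH_bijective n)]

include T in
/-- Transport of surjectivity of the inflation maps. [cite: MochizukiFrdII2008, Thm 2.4 (i) p.19] -/
theorem surjective_iff (n : ℕ) :
    Function.Surjective (ContinuousCohomology.map q (𝟙 (TopRep.res (q : H →* K) X)) n).hom ↔
      Function.Surjective
        (ContinuousCohomology.map q' (𝟙 (TopRep.res (q' : H' →* K') X')) n).hom := by
  have hsq : (T.pullH n).hom ∘ (ContinuousCohomology.map q' (𝟙 _) n).hom =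
      (ContinuousCohomology.map q (𝟙 _) n).hom ∘ (T.pull n).hom :=
    funext fun x => T.square_apply n x
  rw [← Function.Surjective.of_comp_iff _ (T.pull_bijective n).surjective, ← hsq,
    Function.Surjective.of_comp_iff' (T.pullH_bijective n)]

/-- The kernels of the inflation maps correspond under `pull`: `infl (pull x) = 0 ↔ infl' x = 0`.
[cite: MochizukiFrdII2008, Thm 2.4 (i) p.19] -/
theorem map_pull_eq_zero_iff (n : ℕ) (x : continuousCohomology n X') :
    (ContinuousCohomology.map q (𝟙 (TopRep.res (q : H →* K) X)) n).hom ((T.pull n).hom x) = 0 ↔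
      (ContinuousCohomology.map q' (𝟙 (TopRep.res (q' : H' →* K') X')) n).hom x = 0 := by
  rw [← T.square_apply n x]
  constructor
  · intro h
    exact (T.pullH_bijective n).injective (by rw [h, map_zero])
  · intro h
    rw [h, map_zero]

end InflTransport₂

end Transport

/-! ### Transport of condition (c) of Def. 2.2 (ii) and of `F_N(A)` -/

section FN

variable {Γ Γ' : Type} [Group Γ] [TopologicalSpace Γ] [DiscreteTopology Γ]
  [Group Γ'] [TopologicalSpace Γ'] [DiscreteTopology Γ']
  (N : ℕ) (O O' : Type) [CommMonoid O] [MulDistribMulAction Γ O]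
  [CommMonoid O'] [MulDistribMulAction Γ' O']
  {H H' : Type} [Group H] [TopologicalSpace H] [IsTopologicalGroup H]
  [Group H'] [TopologicalSpace H'] [IsTopologicalGroup H']
  (K : Subgroup Γ) (K' : Subgroup Γ') (q : H →ₜ* K) (q' : H' →ₜ* K')

/-- **Condition (c) of Definition 2.2 (ii) transports** along transport data for the coefficients
`μ_N` (in degrees 1 and 2) and `ℤ/Nℤ` (degree 1): `(K, q, O)` satisfies (c) iff `(K', q', O')` does —
the cohomological half of "`Ψ` maps `(N, H₁)`-saturated objects to `(N, H₂)`-saturated objects"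
(Thm. 2.4 (i) p. 19). [cite: MochizukiFrdII2008, Thm 2.4 (i) p.19] -/
theorem isCohSaturated_iff_of_transport
    (Tμ : InflTransport₂ q q' (muTopRep N O K) (muTopRep N O' K'))
    (Tt : InflTransport₂ q q' (trivTopRep N K) (trivTopRep N K')) :
    IsCohSaturated N O K q ↔ IsCohSaturated N O' K' q' := by
  have h1 := Tμ.bijective_iff 1
  have h1' := Tt.bijective_iff 1
  have h2 := Tμ.surjective_iff 2
  constructor
  · rintro ⟨a, b, c⟩
    exact ⟨h1.mp a, h1'.mp b, h2.mp c⟩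
  · rintro ⟨a, b, c⟩
    exact ⟨h1.mpr a, h1'.mpr b, h2.mpr c⟩

variable {N O O' K K' q q'}

/-- `pull` maps `Ker(H²(K', μ_N) → H²(H', μ_N))` onto `Ker(H²(K, μ_N) → H²(H, μ_N))`.
[cite: MochizukiFrdII2008, Thm 2.4 (i) p.19] -/
theorem map_fnKer_pull (T : InflTransport₂ q q' (muTopRep N O K) (muTopRep N O' K')) :
    (fnKer N O' K' q').map (T.pullAddEquiv 2 : _ →+ _) = fnKer N O K q := by
  ext y
  constructor
  · rintro ⟨x, hx, rfl⟩
    change (ContinuousCohomology.map q (𝟙 _) 2).hom ((T.pull 2).hom x) = 0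
    rw [T.map_pull_eq_zero_iff]
    exact hx
  · intro hy
    refine ⟨(T.push 2).hom y, ?_, T.pull_push_apply 2 y⟩
    change (ContinuousCohomology.map q' (𝟙 _) 2).hom ((T.push 2).hom y) = 0
    rw [← T.map_pull_eq_zero_iff, T.pull_push_apply]
    exact hy

/-- **`F_N` transports** (Thm. 2.4 (i) p. 19, "`F_N(A₁) ⥲ F_N(A₂)`"): the isomorphism
`F_N' = H²(K', μ_N)/Ker ≃ H²(K, μ_N)/Ker = F_N` induced by `pull`.
[cite: MochizukiFrdII2008, Thm 2.4 (i) p.19] -/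
noncomputable def InflTransport₂.fnEquiv (T : InflTransport₂ q q' (muTopRep N O K) (muTopRep N O' K')) :
    FN N O' K' q' ≃+ FN N O K q :=
  QuotientAddGroup.congr (fnKer N O' K' q') (fnKer N O K q) (T.pullAddEquiv 2) (map_fnKer_pull T)

/-- `fnEquiv` on the class of `x ∈ H²(K', μ_N)` is the class of `pull x`.
[cite: MochizukiFrdII2008, Thm 2.4 (i) p.19] -/
theorem InflTransport₂.fnEquiv_mk (T : InflTransport₂ q q' (muTopRep N O K) (muTopRep N O' K'))
    (x : continuousCohomology 2 (muTopRep N O' K')) :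
    T.fnEquiv (x : FN N O' K' q') = (((T.pull 2).hom x : continuousCohomology 2 (muTopRep N O K)) :
      FN N O K q) :=
  rfl

end FN

end Kummer

end Literature.AlgebraicGeometry.Frobenioids
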